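import Summits.AtomisticToContinuum.FouriersLaw.Theses.OddSectorIrreversibility
import Summits.AtomisticToContinuum.FouriersLaw.Theorems.OddResponseBound.Negative.OddPairing
import Summits.AtomisticToContinuum.FouriersLaw.Theorems.OddSectorIrreversibilityConeScaleCorrectorStubCentredCorrector
import Summits.AtomisticToContinuum.FouriersLaw.Theorems.OddSectorIrreversibilityConeScaleCorrectorStubSpatialDoob

/-!
# Crux line `spatial-doob-determinacy-area` — checked skeleton for
`OddSectorIrreversibility.ConeScaleCorrector` (E1, item stmt-AtomisticToContinuum-14069)

Idea card `Cruxes/ConeScaleCorrector/Ideas/spatial-doob-determinacy-area.md` (ideator 2, round 1); triage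
r1-1 / r1-2 / r1-3: pass, with the sharpenings acted on here: (i) the glue carries `u ∈ L²(μ_T)` and
`∫ u dμ_T = 0` as an INPUT (`stub_centredCorrector`), not as a by-product; (ii) the conditional-Poincaré /
susceptibility route is NOT a registered stub (gradients of the raw corrector are the risky direction); (iii)
the `k ≤ 1` "universal kill" is its own stub (`stub_contactForecast`).

THE LINE. `μ_T = e^{−H_N/T} dq dp` (unnormalised, mass `Z`), `u` = any a.e.-limit of the finite-horizon Kubo
correctors of the OPEN chain (the crux's predicate, verbatim: `IsCorrectorLimit`). Reveal the initial microstate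
site by site from the left contact: `G_k := σ(q_i, p_i : i < k)` (`leftAlg N k`; `G_0 = ⊥`, `G_N` = Borel),
`E_k := μ_T[u | G_k]`, `Δ_k := E_{k+1} − E_k`. The spatial Doob martingale has orthogonal increments, so for
mean-zero `u ∈ L²(μ_T)`: `∫ u² dμ_T = Σ_{k<N} ∫ Δ_k² dμ_T` EXACTLY (`stub_spatialDoob`, fixed `N`, Mathlib).
E1 = `∫ u² ≤ C N² Z` is then the sum of the DETERMINACY INCREMENT LAW `∫ Δ_k² ≤ C (k+1) Z` ("one more site of
Gibbs data changes the forecast of the total future transport by `O(√k)` in rms" — the strip along the right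
edge of the determinacy triangle, area count `σ̄² k/(2 v_B)`), registered as its two honest `N`-uniform members:
* `stub_contactForecast` (`k ∈ {0,1}`, the contact bond): `‖Δ_0‖² + ‖Δ_1‖² = ‖μ_T[u | q_0,p_0,q_1,p_1]‖² ≤ C·Z` —
  two sites of Gibbs data at the contact predict `O(1)` of the transport. REMARK (planner, for the lead and the
  tenure seat): since `j_0` is `G_2`-measurable, `T² D_N Z = ⟨u, j_0⟩_{μ_T}` (bond sum rule + open-chain
  Green–Kubo, `CorrectorTheory` A(5)+B) `= ⟨E_2, j_0⟩ ≤ ‖E_2‖·‖j_0‖`, so THIS STUB ALONE gives bounded response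
  `D_N ≤ √(C·c)/T²` (`c = sup_N ‖j_0‖²_{μ_T}/Z`, a local Gibbs moment); it is the triage's cheapest universal
  kill made a named target, and it is at least `HasBoundedResponse`-hard.
* `stub_incrementLaw` (`2 ≤ k < N`, LOAD-BEARING for E1 as typed): `∫ Δ_k² ≤ C·k·Z` — the Gibbs-random
  unrevealed exterior scrambles the known interior behind the butterfly front; false for the harmonic member
  (ignorance superposes: `≍ k·N`).
The fixed-`N` input "every a.e.-limit corrector is in `L²(μ_T)` with mean zero" is `stub_centredCorrector`
(CEHR e^{θH}-weighted ergodicity ⇒ everywhere convergence and `|u| ≲ e^{θH}`; `P_t`-invariance of `μ_T` +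
`∫ J_tot dμ_T = 0` ⇒ mean zero; = route support `CorrectorTheory` A(2)–(4) + the Gibbs-invariance clause of
`Literature.…OddSectorLocalityHypothesis`).

Composition: `lineTarget_of_stubs : CentredCorrector → SpatialDoobIdentity → ContactForecastBound → IncrementLaw →
LineTarget` (`LineTarget := ConeScaleCorrector`, `Iff.rfl`) is PROVED below without sorry (termwise bounds,
`Σ_{k<N}(k+1) ≤ N²`), and the skeleton theorem `ConeScaleCorrector_of : OddSectorIrreversibility.ConeScaleCorrector`
(BY NAME, no hypotheses) applies it to the four registered `stub_*` — the only declarations containing `sorry`.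

Disproof.lean (cdisprove cycle 1, read 2026-08-16) honoured: §2a `coneScaleCorrector_false_without_correctorHyp`
— S1, S3, S4 carry the corrector predicate verbatim (`coneScaleCorrector_iff` is `Iff.rfl`); §2b
`coneScaleCorrector_false_without_anharmonicity_of` — S3 (`≍ N²`) and S4 (`≍ k·N`) are false for the harmonic
member, so the line uses `0 < lam, 0 < β` at `stub_contactForecast` and `stub_incrementLaw`; §3/§4
(`corrector_normSq_ge_of_greenKubo`, `coneScaleCorrectorLinear_false_of_coneFloor`) — increments sum to exponent 2,
`Pow 1` is nowhere claimed; §5 `echo_identity` — same constant `κT²/(2v_B)`, space-domain bookkeeping. No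
`-- Targets` kill and no landed `Theorems/ConeScaleCorrector/Negative/` lemma exists yet (cycle 1); negative
lemma FalseOfLocality (OddCorrectorDecay): no `L²(μ_T)`-norm of `P_t`(extensive) inside a time integral appears.
-/

noncomputable section

open MeasureTheory Filter Topology Set
open scoped ENNReal NNReal
open Literature.MathematicalPhysics.KineticTheory.HeatConduction

namespace Summit.AtomisticToContinuum.FouriersLaw.Cruxes.ConeScaleCorrector.SpatialDoobDeterminacyArea

/-! ## §0 Vocabulary (the crux's objects, abbreviated; `coneScaleCorrector_iff` certifies the match) -/

/-- unnormalised Gibbs weight `μ_T = e^{−H_N/T} dq dp` of the chain `P` (the crux's `μT`). -/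
def gibbsW (P : OscillatorChain) (N : ℕ) (T : ℝ) : Measure (PhaseSpace N) :=
  volume.withDensity (fun x : PhaseSpace N => ENNReal.ofReal (Real.exp (-(P.hamiltonian N x) / T)))

/-- its mass `Z = ∫ e^{−H_N/T}` (the crux's right-hand normalisation). -/
def Zmass (P : OscillatorChain) (N : ℕ) (T : ℝ) : ℝ :=
  ∫ x, Real.exp (-(P.hamiltonian N x) / T) ∂(volume : Measure (PhaseSpace N))

/-- total current `J_tot = Σ_i j_i`. -/
def Jtot (P : OscillatorChain) (N : ℕ) : PhaseSpace N → ℝ := fun z => ∑ i : Fin N, P.bondCurrent N i z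

/-- The crux's corrector predicate: `u` is a `μ_T`-a.e. limit, as `τ → ∞`, of the finite-horizon Kubo
correctors `u_τ(x) = ∫₀^τ (P_t J_tot)(x) dt` of the OPEN chain with both baths at `T` (honest kernels
`OscillatorChain.transitionKernel N T T t`). -/
def IsCorrectorLimit (P : OscillatorChain) (N : ℕ) (T : ℝ) (u : PhaseSpace N → ℝ) : Prop :=
  ∀ᵐ x ∂(gibbsW P N T), Tendsto (fun τ : ℝ => ∫ t in Set.Ioc (0 : ℝ) τ,
    (∫ y, Jtot P N y ∂(P.transitionKernel N T T t.toNNReal x))) atTop (𝓝 (u x))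

/-- The σ-algebra `G_k` generated by the first `k` sites `(q_i, p_i)_{i<k}` (`k = 0`: `⊥`; `k ≥ N`: all sites,
i.e. the Borel σ-algebra of `PhaseSpace N` — a lemma inside `stub_spatialDoob`). -/
@[reducible] def leftAlg (N k : ℕ) : MeasurableSpace (PhaseSpace N) :=
  ⨆ (i : Fin N) (_ : i.val < k), MeasurableSpace.comap (fun x : PhaseSpace N => (x.1 i, x.2 i)) inferInstance

/-- Doob level `E_k := μ_T[u | G_k]` (Mathlib `condExp`; `μ_T` is finite and non-zero for `T > 0`, so it is the
genuine conditional expectation for integrable `u`, and `E_0 = (∫u dμ_T)/Z` by `condExp_bot'`). -/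
def doobLevel (P : OscillatorChain) (N : ℕ) (T : ℝ) (k : ℕ) (u : PhaseSpace N → ℝ) : PhaseSpace N → ℝ :=
  (gibbsW P N T)[u|leftAlg N k]

/-- Doob increment `Δ_k := E_{k+1} − E_k`: the change of the forecast when site `k` is revealed. -/
def doobIncrement (P : OscillatorChain) (N : ℕ) (T : ℝ) (k : ℕ) (u : PhaseSpace N → ℝ) :
    PhaseSpace N → ℝ :=
  fun x => doobLevel P N T (k + 1) u x - doobLevel P N T k u x

/-! ### §0b Certified filtration facts (sorry-free; the measure-theoretic spine of `stub_spatialDoob`) -/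

/-- `G_0 = ⊥` (no site revealed). -/
theorem leftAlg_zero (N : ℕ) : leftAlg N 0 = ⊥ := by
  simp [leftAlg]

/-- every `G_k` is a sub-σ-algebra of the Borel (product) σ-algebra of `PhaseSpace N`. -/
theorem leftAlg_le (N k : ℕ) : leftAlg N k ≤ (inferInstance : MeasurableSpace (PhaseSpace N)) := by
  refine iSup₂_le fun i _ => ?_
  refine MeasurableSpace.comap_le_iff_le_map.mpr ?_
  intro s hs
  have h1 : Measurable fun x : PhaseSpace N => x.1 i := (measurable_pi_apply i).comp measurable_fst
  have h2 : Measurable fun x : PhaseSpace N => x.2 i := (measurable_pi_apply i).comp measurable_snd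
  exact (h1.prodMk h2) hs

/-- the filtration is increasing. -/
theorem leftAlg_mono (N : ℕ) {k k' : ℕ} (h : k ≤ k') : leftAlg N k ≤ leftAlg N k' := by
  refine iSup₂_le fun i hi => ?_
  exact le_iSup₂_of_le i (lt_of_lt_of_le hi h) le_rfl

/-- `G_N` is everything: the `2N` coordinates generate the product σ-algebra. -/
theorem le_leftAlg_self (N : ℕ) : (inferInstance : MeasurableSpace (PhaseSpace N)) ≤ leftAlg N N := by
  show Prod.instMeasurableSpace ≤ _
  simp only [Prod.instMeasurableSpace, MeasurableSpace.prod, MeasurableSpace.pi, MeasurableSpace.comap_iSup,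
    MeasurableSpace.comap_comp, sup_le_iff, iSup_le_iff]
  constructor
  · intro i
    refine le_iSup₂_of_le i i.isLt ?_
    calc MeasurableSpace.comap ((fun b : Fin N → ℝ => b i) ∘ Prod.fst) (inferInstance : MeasurableSpace ℝ)
        = MeasurableSpace.comap (Prod.fst ∘ fun x : PhaseSpace N => (x.1 i, x.2 i)) inferInstance := rfl
      _ = MeasurableSpace.comap (fun x : PhaseSpace N => (x.1 i, x.2 i))
            (MeasurableSpace.comap Prod.fst inferInstance) := by
          rw [MeasurableSpace.comap_comp]
      _ ≤ _ := MeasurableSpace.comap_mono (by exact le_sup_left)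
  · intro i
    refine le_iSup₂_of_le i i.isLt ?_
    calc MeasurableSpace.comap ((fun b : Fin N → ℝ => b i) ∘ Prod.snd) (inferInstance : MeasurableSpace ℝ)
        = MeasurableSpace.comap (Prod.snd ∘ fun x : PhaseSpace N => (x.1 i, x.2 i)) inferInstance := rfl
      _ = MeasurableSpace.comap (fun x : PhaseSpace N => (x.1 i, x.2 i))
            (MeasurableSpace.comap Prod.snd inferInstance) := by
          rw [MeasurableSpace.comap_comp]
      _ ≤ _ := MeasurableSpace.comap_mono (by exact le_sup_right)

/-- hence `G_N = Borel` (the `E_N = u` step of the Doob identity). -/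
theorem leftAlg_self_eq (N : ℕ) : leftAlg N N = (inferInstance : MeasurableSpace (PhaseSpace N)) :=
  le_antisymm (leftAlg_le N N) (le_leftAlg_self N)

/-- `μ_T` is a finite measure for admissible parameters (so Mathlib's `condExp` w.r.t. every `G_k` is genuine). -/
theorem isFiniteMeasure_gibbsW {ω₂ lam β : ℝ} (hω : 0 < ω₂) (hl : 0 ≤ lam) (hβ : 0 ≤ β) (γ : ℝ) (N : ℕ)
    {T : ℝ} (hT : 0 < T) : IsFiniteMeasure (gibbsW (pinnedChain ω₂ lam β γ) N T) := by
  unfold gibbsW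
  refine isFiniteMeasure_withDensity_ofReal ?_
  exact (pinnedChain_integrable_gibbsDensity hω hl hβ γ N hT).hasFiniteIntegral

/-- PROBE: the crux, verbatim up to the abbreviations above (definitional unfolding, `Iff.rfl`). -/
theorem coneScaleCorrector_iff :
    Summit.AtomisticToContinuum.FouriersLaw.Theses.OddSectorIrreversibility.ConeScaleCorrector ↔
    (∀ ω₂ lam β γ : ℝ, 0 < ω₂ → 0 < lam → 0 < β → 0 < γ → ∀ T : ℝ, 0 < T → ∃ C : ℝ,
      ∀ (N : ℕ) (u : PhaseSpace N → ℝ),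
      IsCorrectorLimit (pinnedChain ω₂ lam β γ) N T u →
        MemLp u 2 (gibbsW (pinnedChain ω₂ lam β γ) N T) ∧
        ∫ x, (u x) ^ 2 ∂(gibbsW (pinnedChain ω₂ lam β γ) N T) ≤
          C * (N : ℝ) ^ 2 * Zmass (pinnedChain ω₂ lam β γ) N T) :=
  Iff.rfl

/-- Local name of the line's target (definitionally the crux; lets the sorry-free composition be stated as an
implication while `ConeScaleCorrector_of` below stays the file's unique hypothesis-free skeleton theorem). -/
def LineTarget : Prop := Summit.AtomisticToContinuum.FouriersLaw.Theses.OddSectorIrreversibility.ConeScaleCorrector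

theorem lineTarget_iff :
    LineTarget ↔ Summit.AtomisticToContinuum.FouriersLaw.Theses.OddSectorIrreversibility.ConeScaleCorrector := Iff.rfl

/-! ## §1 Stub statements -/

/-- S1 `CentredCorrector` (fixed `N`; size L): every a.e.-limit `u` of the finite-horizon correctors is in
`L²(μ_T)` and has MEAN ZERO. Why true: by CEHR2018 Thm 2.13(3) (e^{θH}-weighted exponential ergodicity,
`θ < 1/(2T)`) `u_τ → u⋆` everywhere with `|u⋆| ≲ e^{θH} ∈ L²(μ_T)`, so any a.e.-limit equals `u⋆` a.e.;
`∫ u_τ dμ_T = ∫₀^τ ∫ J_tot dμ_T dt = 0` by `P_t`-invariance of `μ_T` and `pinnedChain_integral_bondCurrent_gibbsMeasure`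
(`J_tot` odd in `p`), and dominated convergence. For `N ≤ 1`, `J_tot ≡ 0` and `u = 0` a.e. Leans on route support
`CorrectorTheory` A(2)–(4) (a.e.- and L²-limit) + invariance of `μ_T` under `transitionKernel N T T t` (clause 1 of
`OddSectorLocalityHypothesis`; construction pending). -/
def CentredCorrector : Prop :=
  ∀ ω₂ lam β γ : ℝ, 0 < ω₂ → 0 < lam → 0 < β → 0 < γ → ∀ T : ℝ, 0 < T →
    ∀ (N : ℕ) (u : PhaseSpace N → ℝ), IsCorrectorLimit (pinnedChain ω₂ lam β γ) N T u →
      MemLp u 2 (gibbsW (pinnedChain ω₂ lam β γ) N T) ∧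
      ∫ x, u x ∂(gibbsW (pinnedChain ω₂ lam β γ) N T) = 0

/-- S2 `SpatialDoobIdentity` (fixed `N`; size M; pure measure theory — the card's FIRST LEMMA): for a mean-zero
`u ∈ L²(μ_T)` the Doob martingale `E_k = μ_T[u|G_k]` along `G_0 ≤ G_1 ≤ … ≤ G_N` has `E_0 = 0`
(`condExp_bot'`, `NeZero μ_T`), `E_N = u` a.e. (`G_N` = Borel: the coordinates generate the product σ-algebra)
and orthogonal increments (`condExp_condExp_of_le` + pull-out), hence `∫ u² dμ_T = Σ_{k<N} ∫ Δ_k² dμ_T`.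
True also for `N = 0` (both sides `0`: `u` is the constant `(∫u)/Z = 0`). -/
def SpatialDoobIdentity : Prop :=
  ∀ ω₂ lam β γ : ℝ, 0 < ω₂ → 0 < lam → 0 < β → 0 < γ → ∀ T : ℝ, 0 < T →
    ∀ (N : ℕ) (u : PhaseSpace N → ℝ),
      MemLp u 2 (gibbsW (pinnedChain ω₂ lam β γ) N T) →
      ∫ x, u x ∂(gibbsW (pinnedChain ω₂ lam β γ) N T) = 0 →
        ∫ x, (u x) ^ 2 ∂(gibbsW (pinnedChain ω₂ lam β γ) N T) =
          ∑ k : Fin N, ∫ x, (doobIncrement (pinnedChain ω₂ lam β γ) N T k.val u x) ^ 2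
            ∂(gibbsW (pinnedChain ω₂ lam β γ) N T)

/-- S3 `ContactForecastBound` (`N`-uniform; the CONTACT-BOND instance `k ∈ {0,1}` of the increment law; size:
open-problem, at least `HasBoundedResponse`-hard): the initial microstate `(q_0,p_0,q_1,p_1)` of the two sites of
the contact bond predicts `O(1)` of the total future transport, uniformly in `N`:
`‖Δ_0‖² + ‖Δ_1‖² (= ‖μ_T[u | G_2]‖², since `E_0 = 0`) ≤ C·Z`. Mechanism: `p_0` is re-randomised by the bath in time
`1/γ`; the revealed energy exits left or right with the EXIT ANTISYMMETRY of a normal conductor (net hydrodynamic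
forecast `O(ℓ)·δE`, transmission to the far bath `O(1/N)`); the revealed phase is scrambled by the unknown site 2
onward. COROLLARY (one Cauchy–Schwarz, see header): `T² D_N ≤ ‖E_2‖_{μ_T} ‖j_0‖_{μ_T} / Z`, so S3 ⇒ bounded
response given `CorrectorTheory`. Harmonic member: `‖E_2‖² ≍ N²` (two sites fix a phonon's direction; it
crosses ballistically) — fails as it must (Disproof §2b). This is the triage's "k = 1 universal kill" as a target. -/
def ContactForecastBound : Prop :=
  ∀ ω₂ lam β γ : ℝ, 0 < ω₂ → 0 < lam → 0 < β → 0 < γ → ∀ T : ℝ, 0 < T → ∃ C : ℝ,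
    ∀ (N : ℕ) (u : PhaseSpace N → ℝ), IsCorrectorLimit (pinnedChain ω₂ lam β γ) N T u →
      (∫ x, (doobIncrement (pinnedChain ω₂ lam β γ) N T 0 u x) ^ 2 ∂(gibbsW (pinnedChain ω₂ lam β γ) N T)) +
        ∫ x, (doobIncrement (pinnedChain ω₂ lam β γ) N T 1 u x) ^ 2 ∂(gibbsW (pinnedChain ω₂ lam β γ) N T) ≤
        C * Zmass (pinnedChain ω₂ lam β γ) N T

/-- S4 `IncrementLaw` (`N`-uniform; LOAD-BEARING for E1 as typed; open-problem): the DETERMINACY INCREMENT LAW in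
the bulk — for `2 ≤ k < N`, revealing site `k` given the sites to its left changes the forecast of the total
future transport by at most `O(√k)` in `L²(μ_T)`: `∫ Δ_k² dμ_T ≤ C·k·Z`. Heuristic value `C ≈ σ̄²/(2v_B)`,
`σ̄² = 2κ_GK T²` (Einstein–Helfand count over the strip where site `k` is the first unknown to arrive); consistency
checks passed in triage: `k = N−1` p-direction = tap energy identity (F5), quadratic hydro sector `∝ k` (F4).
Harmonic member `≍ k·N` (ignorance superposes; only nonlinearity lets the unknown exterior scramble the known
interior) — fails as it must. By the spatial Markov property of `e^{−H_N/T}`, `‖Δ_k‖² = E_{μ_T} Var(E_{k+1} | G_k)`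
with an explicit one-site conditional law depending on `q_{k−1}` only — the entry point of any proof. -/
def IncrementLaw : Prop :=
  ∀ ω₂ lam β γ : ℝ, 0 < ω₂ → 0 < lam → 0 < β → 0 < γ → ∀ T : ℝ, 0 < T → ∃ C : ℝ,
    ∀ (N : ℕ) (u : PhaseSpace N → ℝ), IsCorrectorLimit (pinnedChain ω₂ lam β γ) N T u →
      ∀ k : ℕ, 2 ≤ k → k < N →
        ∫ x, (doobIncrement (pinnedChain ω₂ lam β γ) N T k u x) ^ 2 ∂(gibbsW (pinnedChain ω₂ lam β γ) N T) ≤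
          C * (k : ℝ) * Zmass (pinnedChain ω₂ lam β γ) N T

/-! ## §2 Registered stubs (the only sorries of the file)

RESHAPED by the lead (2026-08-16): each `stub_*` is stated in the crux's RAW tree vocabulary
(`volume.withDensity e^{-H/T}`, `MeasureTheory.condExp` over the explicit `⨆`-σ-algebra, the kernels' Bochner
integrals), so that a prover's `Theorems/` file — which cannot import this Cruxes workfile — restates the registered
signature verbatim with NO local definition. The abbreviated Props `CentredCorrector` … `IncrementLaw` of §1 are
definitionally these statements (the `*_of_stub` terms below elaborate by unfolding only), and `ConeScaleCorrector_of`
feeds the raw stubs to the unchanged sorry-free composition `lineTarget_of_stubs`.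
FINAL STATE (lead, line declared dead at the N-uniform stubs): S1 and S2 CLOSED (imported from Theorems/), S3 and S4 OPEN. -/

/-- stub S1 (fixed `N`) — CLOSED: landed as `Theorems/OddSectorIrreversibilityConeScaleCorrectorStubCentredCorrector.lean`
(p84813). Every `μ_T`-a.e. limit `u` of the finite-horizon Kubo correctors is in `L²(μ_T)` and has `∫ u dμ_T = 0`. -/
theorem stub_centredCorrector :
    ∀ ω₂ lam β γ : ℝ, 0 < ω₂ → 0 < lam → 0 < β → 0 < γ → ∀ T : ℝ, 0 < T →
    ∀ (N : ℕ) (u : PhaseSpace N → ℝ),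
    (∀ᵐ x ∂(volume.withDensity fun x : PhaseSpace N =>
        ENNReal.ofReal (Real.exp (-((pinnedChain ω₂ lam β γ).hamiltonian N x) / T))),
      Tendsto (fun τ : ℝ => ∫ t in Set.Ioc (0 : ℝ) τ,
          ∫ y, (∑ i : Fin N, (pinnedChain ω₂ lam β γ).bondCurrent N i y)
            ∂((pinnedChain ω₂ lam β γ).transitionKernel N T T t.toNNReal x)) atTop (𝓝 (u x))) →
    MemLp u 2 (volume.withDensity fun x : PhaseSpace N =>
        ENNReal.ofReal (Real.exp (-((pinnedChain ω₂ lam β γ).hamiltonian N x) / T))) ∧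
    ∫ x, u x ∂(volume.withDensity fun x : PhaseSpace N =>
        ENNReal.ofReal (Real.exp (-((pinnedChain ω₂ lam β γ).hamiltonian N x) / T))) = 0 :=
  Summit.AtomisticToContinuum.FouriersLaw.Theorems.OddSectorIrreversibility.stub_centredCorrector

/-- stub S2 (fixed `N`) — CLOSED: landed as `Theorems/OddSectorIrreversibilityConeScaleCorrectorStubSpatialDoob.lean`
(p85451). The orthogonal-increment identity of the spatial Doob martingale for mean-zero `u ∈ L²(μ_T)`. -/
theorem stub_spatialDoob :
    ∀ ω₂ lam β γ : ℝ, 0 < ω₂ → 0 < lam → 0 < β → 0 < γ → ∀ T : ℝ, 0 < T →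
    ∀ (N : ℕ) (u : PhaseSpace N → ℝ),
    MemLp u 2 (volume.withDensity fun x : PhaseSpace N =>
        ENNReal.ofReal (Real.exp (-((pinnedChain ω₂ lam β γ).hamiltonian N x) / T))) →
    ∫ x, u x ∂(volume.withDensity fun x : PhaseSpace N =>
        ENNReal.ofReal (Real.exp (-((pinnedChain ω₂ lam β γ).hamiltonian N x) / T))) = 0 →
    ∫ x, (u x) ^ 2 ∂(volume.withDensity fun x : PhaseSpace N =>
        ENNReal.ofReal (Real.exp (-((pinnedChain ω₂ lam β γ).hamiltonian N x) / T))) =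
      ∑ k : Fin N, ∫ x, (MeasureTheory.condExp
          (⨆ (i : Fin N) (_ : i.val < (k.val + 1)),
            MeasurableSpace.comap (fun x : PhaseSpace N => (x.1 i, x.2 i)) inferInstance)
          (volume.withDensity fun x : PhaseSpace N =>
        ENNReal.ofReal (Real.exp (-((pinnedChain ω₂ lam β γ).hamiltonian N x) / T))) u x
        - MeasureTheory.condExp
          (⨆ (i : Fin N) (_ : i.val < k.val),
            MeasurableSpace.comap (fun x : PhaseSpace N => (x.1 i, x.2 i)) inferInstance)
          (volume.withDensity fun x : PhaseSpace N =>
        ENNReal.ofReal (Real.exp (-((pinnedChain ω₂ lam β γ).hamiltonian N x) / T))) u x) ^ 2 ∂(volume.withDensity fun x : PhaseSpace N =>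
        ENNReal.ofReal (Real.exp (-((pinnedChain ω₂ lam β γ).hamiltonian N x) / T))) :=
  Summit.AtomisticToContinuum.FouriersLaw.Theorems.OddSectorIrreversibility.stub_spatialDoob

/-- stub S3 (`N`-uniform; ≥ `HasBoundedResponse`-hard) — OPEN: the two sites of the contact bond predict `O(1)` of the
total future transport: `∫ (E_1 − E_0)² dμ_T + ∫ (E_2 − E_1)² dμ_T ≤ C · Z` for every corrector limit `u`,
uniformly in `N` (`E_k = μ_T[u | σ(q_i,p_i : i<k)]`). -/
theorem stub_contactForecast :
    ∀ ω₂ lam β γ : ℝ, 0 < ω₂ → 0 < lam → 0 < β → 0 < γ → ∀ T : ℝ, 0 < T → ∃ C : ℝ,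
    ∀ (N : ℕ) (u : PhaseSpace N → ℝ),
    (∀ᵐ x ∂(volume.withDensity fun x : PhaseSpace N =>
        ENNReal.ofReal (Real.exp (-((pinnedChain ω₂ lam β γ).hamiltonian N x) / T))),
      Tendsto (fun τ : ℝ => ∫ t in Set.Ioc (0 : ℝ) τ,
          ∫ y, (∑ i : Fin N, (pinnedChain ω₂ lam β γ).bondCurrent N i y)
            ∂((pinnedChain ω₂ lam β γ).transitionKernel N T T t.toNNReal x)) atTop (𝓝 (u x))) →
    (∫ x, (MeasureTheory.condExp
          (⨆ (i : Fin N) (_ : i.val < (0 + 1)),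
            MeasurableSpace.comap (fun x : PhaseSpace N => (x.1 i, x.2 i)) inferInstance)
          (volume.withDensity fun x : PhaseSpace N =>
        ENNReal.ofReal (Real.exp (-((pinnedChain ω₂ lam β γ).hamiltonian N x) / T))) u x
        - MeasureTheory.condExp
          (⨆ (i : Fin N) (_ : i.val < 0),
            MeasurableSpace.comap (fun x : PhaseSpace N => (x.1 i, x.2 i)) inferInstance)
          (volume.withDensity fun x : PhaseSpace N =>
        ENNReal.ofReal (Real.exp (-((pinnedChain ω₂ lam β γ).hamiltonian N x) / T))) u x) ^ 2 ∂(volume.withDensity fun x : PhaseSpace N =>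
        ENNReal.ofReal (Real.exp (-((pinnedChain ω₂ lam β γ).hamiltonian N x) / T)))) +
      ∫ x, (MeasureTheory.condExp
          (⨆ (i : Fin N) (_ : i.val < (1 + 1)),
            MeasurableSpace.comap (fun x : PhaseSpace N => (x.1 i, x.2 i)) inferInstance)
          (volume.withDensity fun x : PhaseSpace N =>
        ENNReal.ofReal (Real.exp (-((pinnedChain ω₂ lam β γ).hamiltonian N x) / T))) u x
        - MeasureTheory.condExp
          (⨆ (i : Fin N) (_ : i.val < 1),
            MeasurableSpace.comap (fun x : PhaseSpace N => (x.1 i, x.2 i)) inferInstance)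
          (volume.withDensity fun x : PhaseSpace N =>
        ENNReal.ofReal (Real.exp (-((pinnedChain ω₂ lam β γ).hamiltonian N x) / T))) u x) ^ 2 ∂(volume.withDensity fun x : PhaseSpace N =>
        ENNReal.ofReal (Real.exp (-((pinnedChain ω₂ lam β γ).hamiltonian N x) / T))) ≤
      C * (∫ x : PhaseSpace N, Real.exp (-((pinnedChain ω₂ lam β γ).hamiltonian N x) / T)) := by
  sorry

/-- stub S4 (`N`-uniform, LOAD-BEARING; open-problem sized) — OPEN: the determinacy increment law in the bulk,
`∫ (E_{k+1} − E_k)² dμ_T ≤ C · k · Z` for `2 ≤ k < N` and every corrector limit `u`, uniformly in `N`. -/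
theorem stub_incrementLaw :
    ∀ ω₂ lam β γ : ℝ, 0 < ω₂ → 0 < lam → 0 < β → 0 < γ → ∀ T : ℝ, 0 < T → ∃ C : ℝ,
    ∀ (N : ℕ) (u : PhaseSpace N → ℝ),
    (∀ᵐ x ∂(volume.withDensity fun x : PhaseSpace N =>
        ENNReal.ofReal (Real.exp (-((pinnedChain ω₂ lam β γ).hamiltonian N x) / T))),
      Tendsto (fun τ : ℝ => ∫ t in Set.Ioc (0 : ℝ) τ,
          ∫ y, (∑ i : Fin N, (pinnedChain ω₂ lam β γ).bondCurrent N i y)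
            ∂((pinnedChain ω₂ lam β γ).transitionKernel N T T t.toNNReal x)) atTop (𝓝 (u x))) →
    ∀ k : ℕ, 2 ≤ k → k < N →
      ∫ x, (MeasureTheory.condExp
          (⨆ (i : Fin N) (_ : i.val < (k + 1)),
            MeasurableSpace.comap (fun x : PhaseSpace N => (x.1 i, x.2 i)) inferInstance)
          (volume.withDensity fun x : PhaseSpace N =>
        ENNReal.ofReal (Real.exp (-((pinnedChain ω₂ lam β γ).hamiltonian N x) / T))) u x
        - MeasureTheory.condExp
          (⨆ (i : Fin N) (_ : i.val < k),
            MeasurableSpace.comap (fun x : PhaseSpace N => (x.1 i, x.2 i)) inferInstance)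
          (volume.withDensity fun x : PhaseSpace N =>
        ENNReal.ofReal (Real.exp (-((pinnedChain ω₂ lam β γ).hamiltonian N x) / T))) u x) ^ 2 ∂(volume.withDensity fun x : PhaseSpace N =>
        ENNReal.ofReal (Real.exp (-((pinnedChain ω₂ lam β γ).hamiltonian N x) / T))) ≤
        C * (k : ℝ) * (∫ x : PhaseSpace N, Real.exp (-((pinnedChain ω₂ lam β γ).hamiltonian N x) / T)) := by
  sorry

/-! ### The §1 Props are definitionally the raw stub statements (elaboration by unfolding only) -/

/-- `CentredCorrector` from the raw stub S1 (definitional). -/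
theorem centredCorrector_of_stub : CentredCorrector := stub_centredCorrector
/-- `SpatialDoobIdentity` from the raw stub S2 (definitional). -/
theorem spatialDoobIdentity_of_stub : SpatialDoobIdentity := stub_spatialDoob
/-- `ContactForecastBound` from the raw stub S3 (definitional). -/
theorem contactForecastBound_of_stub : ContactForecastBound := stub_contactForecast
/-- `IncrementLaw` from the raw stub S4 (definitional). -/
theorem incrementLaw_of_stub : IncrementLaw := stub_incrementLaw

/-! ## §3 The composition (kernel-checked, no sorry) -/

theorem Zmass_nonneg (P : OscillatorChain) (N : ℕ) (T : ℝ) : 0 ≤ Zmass P N T :=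
  integral_nonneg fun _ => (Real.exp_pos _).le

/-- `Σ_{k<N} (k+1) ≤ N²` in `ℝ`. -/
theorem sum_succ_le_sq (N : ℕ) : ∑ k : Fin N, ((k.val : ℝ) + 1) ≤ (N : ℝ) ^ 2 := by
  calc ∑ k : Fin N, ((k.val : ℝ) + 1) ≤ ∑ _k : Fin N, (N : ℝ) := by
        refine Finset.sum_le_sum fun k _ => ?_
        have : (k.val : ℝ) + 1 ≤ N := by exact_mod_cast k.isLt
        exact this
    _ = (N : ℝ) ^ 2 := by simp [Finset.sum_const, sq]

/-- **Composition (sorry-free implication).** The four stub STATEMENTS imply the crux: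
`∫u² = Σ_{k<N} ‖Δ_k‖²` (S2, with `u ∈ L²`, mean zero from S1) `≤ Σ_{k<N} M (k+1) Z ≤ M N² Z`
(S3 for `k ≤ 1`, S4 for `k ≥ 2`, `M = max C₀ 0 + max C₁ 0`). -/
theorem lineTarget_of_stubs :
    CentredCorrector → SpatialDoobIdentity → ContactForecastBound → IncrementLaw → LineTarget := by
  intro h1 h2 h3 h4
  rw [lineTarget_iff, coneScaleCorrector_iff]
  intro ω₂ lam β γ hω hl hβ hγ T hT
  obtain ⟨C₀, hC₀⟩ := h3 ω₂ lam β γ hω hl hβ hγ T hT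
  obtain ⟨C₁, hC₁⟩ := h4 ω₂ lam β γ hω hl hβ hγ T hT
  set M : ℝ := max C₀ 0 + max C₁ 0 with hM_def
  have hM0 : max C₀ 0 ≤ M := by
    have := le_max_right C₁ 0; linarith
  have hM1 : max C₁ 0 ≤ M := by
    have := le_max_right C₀ 0; linarith
  have hMnn : 0 ≤ M := le_trans (le_max_right C₀ 0) hM0
  refine ⟨M, fun N u hu => ?_⟩
  set P := pinnedChain ω₂ lam β γ with hP_def
  obtain ⟨hL2, hmean⟩ := h1 ω₂ lam β γ hω hl hβ hγ T hT N u hu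
  refine ⟨hL2, ?_⟩
  have hZ : 0 ≤ Zmass P N T := Zmass_nonneg P N T
  rw [h2 ω₂ lam β γ hω hl hβ hγ T hT N u hL2 hmean]
  -- the contact bound controls the increments `k = 0` and `k = 1` separately (both integrals are ≥ 0)
  have hI0 : 0 ≤ ∫ x, (doobIncrement P N T 0 u x) ^ 2 ∂(gibbsW P N T) := integral_nonneg fun _ => sq_nonneg _
  have hI1 : 0 ≤ ∫ x, (doobIncrement P N T 1 u x) ^ 2 ∂(gibbsW P N T) := integral_nonneg fun _ => sq_nonneg _
  have hc := hC₀ N u hu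
  have h0 : ∫ x, (doobIncrement P N T 0 u x) ^ 2 ∂(gibbsW P N T) ≤ M * Zmass P N T := by
    calc ∫ x, (doobIncrement P N T 0 u x) ^ 2 ∂(gibbsW P N T) ≤ C₀ * Zmass P N T := by linarith
      _ ≤ M * Zmass P N T := mul_le_mul_of_nonneg_right ((le_max_left C₀ 0).trans hM0) hZ
  have h1' : ∫ x, (doobIncrement P N T 1 u x) ^ 2 ∂(gibbsW P N T) ≤ M * Zmass P N T := by
    calc ∫ x, (doobIncrement P N T 1 u x) ^ 2 ∂(gibbsW P N T) ≤ C₀ * Zmass P N T := by linarith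
      _ ≤ M * Zmass P N T := mul_le_mul_of_nonneg_right ((le_max_left C₀ 0).trans hM0) hZ
  have key : ∀ k : Fin N,
      ∫ x, (doobIncrement P N T k.val u x) ^ 2 ∂(gibbsW P N T) ≤ M * ((k.val : ℝ) + 1) * Zmass P N T := by
    intro k
    have hMZ : 0 ≤ M * Zmass P N T := mul_nonneg hMnn hZ
    rcases Nat.lt_or_ge k.val 2 with hk | hk
    · -- k = 0 or k = 1
      interval_cases hkv : k.val
      · calc ∫ x, (doobIncrement P N T 0 u x) ^ 2 ∂(gibbsW P N T) ≤ M * Zmass P N T := h0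
          _ = M * (((0 : ℕ) : ℝ) + 1) * Zmass P N T := by norm_num
      · calc ∫ x, (doobIncrement P N T 1 u x) ^ 2 ∂(gibbsW P N T) ≤ M * Zmass P N T := h1'
          _ ≤ M * (((1 : ℕ) : ℝ) + 1) * Zmass P N T := by norm_num; nlinarith
    · calc ∫ x, (doobIncrement P N T k.val u x) ^ 2 ∂(gibbsW P N T) ≤ C₁ * (k.val : ℝ) * Zmass P N T :=
            hC₁ N u hu k.val hk k.isLt
        _ ≤ M * (k.val : ℝ) * Zmass P N T := by
            refine mul_le_mul_of_nonneg_right ?_ hZ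
            exact mul_le_mul_of_nonneg_right ((le_max_left C₁ 0).trans hM1) (Nat.cast_nonneg _)
        _ ≤ M * ((k.val : ℝ) + 1) * Zmass P N T := by
            refine mul_le_mul_of_nonneg_right ?_ hZ
            exact mul_le_mul_of_nonneg_left (by linarith) hMnn
  calc ∑ k : Fin N, ∫ x, (doobIncrement P N T k.val u x) ^ 2 ∂(gibbsW P N T)
      ≤ ∑ k : Fin N, M * ((k.val : ℝ) + 1) * Zmass P N T := Finset.sum_le_sum fun k _ => key k
    _ = M * Zmass P N T * ∑ k : Fin N, ((k.val : ℝ) + 1) := by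
        rw [Finset.mul_sum]
        refine Finset.sum_congr rfl fun k _ => ?_
        ring
    _ ≤ M * Zmass P N T * (N : ℝ) ^ 2 :=
        mul_le_mul_of_nonneg_left (sum_succ_le_sq N) (mul_nonneg hMnn hZ)
    _ = M * (N : ℝ) ^ 2 * Zmass P N T := by ring

/-- **THE SKELETON THEOREM.** The crux `OddSectorIrreversibility.ConeScaleCorrector` BY NAME, from the four registered
stubs (the only `sorry`s of the file) through the sorry-free composition `lineTarget_of_stubs`. -/
theorem ConeScaleCorrector_of :
    Summit.AtomisticToContinuum.FouriersLaw.Theses.OddSectorIrreversibility.ConeScaleCorrector :=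
  lineTarget_of_stubs centredCorrector_of_stub spatialDoobIdentity_of_stub contactForecastBound_of_stub
    incrementLaw_of_stub

/-! ## §4 Certified step of the planner corollary `stub_contactForecast ⇒ bounded response` (sorry-free)

Pairing `u` against an `m`-measurable square-integrable `j` only sees `μ[u|m]`, so
`(∫ u j dμ)² ≤ (∫ μ[u|m]² dμ)(∫ j² dμ)`. With `μ = μ_T`, `m = G_2 = leftAlg N 2`, `j = j_0 = −½(p_0+p_1)V′(q_1−q_0)`
(`G_2`-measurable) and `∫ u j_0 dμ_T = T² D_N Z` (bond sum rule + open-chain Green–Kubo, route support `CorrectorTheory`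
A(4)(5)+B, `N ≥ 3`), `ContactForecastBound` (`∫ μ_T[u|G_2]² ≤ C Z`, using `E_0 = 0` and orthogonality) gives
`T⁴ D_N² Z² ≤ (C Z)(c Z)`, i.e. `|D_N| ≤ √(C c)/T²`: bounded response from the first two Doob increments alone. -/

open Summit.AtomisticToContinuum.FouriersLaw.Theorems.OddResponseBound.Negative.OddPairing in
theorem sq_integral_mul_le_condExp {α : Type*} {m m₀ : MeasurableSpace α} {μ : Measure α} (hm : m ≤ m₀)
    [IsFiniteMeasure μ] {u j : α → ℝ} (hu : MemLp u 2 μ) (hj : MemLp j 2 μ) (hjm : StronglyMeasurable[m] j) :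
    (∫ x, u x * j x ∂μ) ^ 2 ≤ (∫ x, (μ[u|m]) x ^ 2 ∂μ) * ∫ x, j x ^ 2 ∂μ := by
  have hint : Integrable (u * j) μ := hu.integrable_mul hj
  have hu1 : Integrable u μ := hu.integrable one_le_two
  have h2 : μ[u * j|m] =ᵐ[μ] μ[u|m] * j := condExp_mul_of_stronglyMeasurable_right hjm hint hu1
  have h1 : ∫ x, u x * j x ∂μ = ∫ x, (μ[u|m]) x * j x ∂μ := by
    calc ∫ x, u x * j x ∂μ = ∫ x, (u * j) x ∂μ := rfl
      _ = ∫ x, (μ[u * j|m]) x ∂μ := (integral_condExp hm).symm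
      _ = ∫ x, (μ[u|m] * j) x ∂μ := integral_congr_ae h2
      _ = ∫ x, (μ[u|m]) x * j x ∂μ := rfl
  rw [h1]
  exact sq_integral_mul_le (hu.condExp (m := m) one_le_two) hj

end Summit.AtomisticToContinuum.FouriersLaw.Cruxes.ConeScaleCorrector.SpatialDoobDeterminacyArea
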